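import Literature.NumberTheory.Sieve.CubicFormClassBrunTitchmarsh
import HarnessLib

/-!
# The two-dimensional sieve for `n = (x³ + 2y³) + m` with both summands rough, PROVED (Fundamental Lemma form)

Topic `Literature/NumberTheory/Sieve`, namespace `Literature.NumberTheory.Sieve.CubicPrimes`; companion of
`CubicFormClassBrunTitchmarsh.lean` (the PAIR sieve on a box of pairs `(x, y)` with the classes
`q ∣ x³ + 2y³` removed, trivial lattice-point remainders) and of `CubicFormLocalCount.lean` (the local
counts `N_p(a) = #{(x, y) mod p : x³ + 2y³ ≡ a}`: `N_p(0) = 1 + (p−1)ν_p`, `N_p(a) = p` for `3 ∤ p − 1`,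
Hasse `|N_p(a) − (p+1−ν_p)| ≤ 2√p` for `a ≢ 0`, [IrelandRosen1990, Ch. 8]).  Here the pair sieve is run
with TWO removed value classes modulo each prime, `x³ + 2y³ ≡ 0` and `x³ + 2y³ ≡ n (mod p)`, i.e. the
sifted quantity is

  `T(z) = #{(x, y) : A < x ≤ A+L, A' < y ≤ A'+L, (x³+2y³, P(z)) = 1, (n − x³ − 2y³, P(z)) = 1}`,

the number of pairs of the box for which BOTH `v = x³ + 2y³` and its complement `n − v` are free of
prime factors `< z` — the sieve quantity of the binary problem `n = v + m` with `v` a value of the norm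
form and `m` rough (in the parity-ideate cell: the main term `∑_k ũ(k) g(n−k)` of the dispersion route
for `n = p + (x³ + 2y³)`, `g` the rough model, `ũ` the sieve model of the Heath-Brown weight).  We PROVE
the two-sided FUNDAMENTAL LEMMA estimate for it, for EVEN `n` exceeding every value on the box
(`(A+L)³ + 2(A'+L)³ < n`) and all `2 ≤ z ≤ D`, `2 ≤ D`:

* **`abs_twoClassCount_box_sub_le`** —
  `|T(z) − L² · V_n(z)| ≤ C · L² V_n(z) · e^{−log D/log z} + C · (L + D) D (log D)^16`,
  `V_n(z) = ∏_{p<z} (1 − Ω_n(p)/p²)` (`twoClassProduct`), with an ABSOLUTE `C` (uniform in `n` and the box);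
* the local count `Ω_n(q) = #{(u, w) mod q : (u³+2w³)(n − u³ − 2w³) ≡ 0}` (`twoClassCount`):
  **`twoClassCount_prime_of_dvd`** (`Ω_n(p) = N_p(0) = ω(p)` for `p ∣ n`),
  **`twoClassCount_prime_of_not_dvd`** (`Ω_n(p) = ω(p) + N_p(n)` for `p ∤ n`), `twoClassCount_mul`
  (CRT), `twoClassCount_prime_le` (`Ω_n(p) ≤ 5p` for even `n`), `hasSieveDimension_twoClassDensity`
  (`Ω(5)` with an absolute constant, for even `n`; for odd `n` the prime `2` removes everything);
* the one-class companion on the same box, two-sided: **`abs_oneClassCount_box_sub_le`** —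
  `|#{(x,y) in the box : (x³+2y³, P(z)) = 1} − L² V(z)| ≤ C(L² V(z) e^{−log D/log z} + (L+D)D(log D)⁸)`,
  `V(z) = ∏_{p<z}(1 − ω(p)/p²)` (`oneClassProduct`; the case `d = 1` of the class sieve of
  `CubicFormClassBrunTitchmarsh`, lower half included), with `oneClassProduct_pos/_le_one` and
  **`oneClassProduct_ge`** (`V(z) ≥ (K (log z/log 2)³)⁻¹`, the `Ω(3)` condition);
* the LOCAL FACTORS, uniformly in even `n` (Hasse): **`localFactorConst_mul_oneClassProduct_le`** —
  `c₁ · V(z) ≤ V_n(z) · P(z)/φ(P(z))` for every `z` and every even `n`, with an absolute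
  `c₁ = localFactorConst > 0` (`exp_neg_localExponent_mul_le`: at each prime the factor
  `(1 − Ω_n(p)/p²)(p/(p−1))/(1 − ω(p)/p²)` is `≥ 1/4`, and `≥ 1 − 16 p^{−3/2}` for `p ≥ 11` since
  `N_p(n) ≤ p + 1 + 2√p`); and the packaged main term **`twoClassCount_box_weighted_ge`** —
  `(P(z)/φ(P(z))) T(z) ≥ c₁ L² V(z) − C (L² V(z) e^{−log D/log z} + (P(z)/φ(P(z))) (L+D) D (log D)^16)`.

Method [HalberstamRichert1974, Thm 2.5 with Thm 2.2]: the tree's PROVED uniform Fundamental Lemma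
`SieveSequence.fundamental_lemma_uniform_holds` (dimension `5`, constant `twoClassDimConst`) for the
sequence `a_k = #{(x,y) in the box : v(n − v) = k}` (so that `𝒜_q` counts `q ∣ v(n−v)`, i.e. for
square-free `q`, `v ≡ 0` or `≡ n` modulo every `p ∣ q`), size `L²`, density `Ω_n(q)/q²`
(multiplicative); the Type-I remainders are trivial lattice counts
(`abs_card_Ioc_filter_modEq_sub_le`: `|#{A < x ≤ A+L : x ≡ c (q)} − L/q| ≤ 1`) summed over the
`Ω_n(q) ≤ τ(q)³ q` removed classes, `∑_{q≤D} τ(q)³ ≪ D(log D)^16` (`DivisorPowerSums`).  Local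
factors: `1 − Ω_n(p)/p² = (1 − ω(p)/p²)(1 − N_p(n)/(p² − ω(p)))` for `p ∤ n`, and the Hasse bound
(`abs_cubicPairCount_sub_le`, [IrelandRosen1990, Ch. 8]) gives
`(1 − N_p(n)/(p² − ω(p)))·p/(p−1) ≥ 1 − 16 p^{−3/2}` (`p ≥ 11`), whence
`∏_{p<z} ≥ exp(−∑_p t(p)) = c₁` with `t(p) = 32 p^{−3/2}` (`p ≥ 11`), `log 4` (`p < 11`), summable.

## References

* [HalberstamRichert1974] H. Halberstam, H.-E. Richert, *Sieve Methods*, Academic Press 1974: Thm 2.5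
  (Fundamental Lemma, two-sided), Thm 2.2 (trivial remainders), Ch. 2 §8 / (1.4.14) (sifting a binary
  problem `n = a + b` by the polynomial `a(n − a)`, two classes per prime).
* [IrelandRosen1990] K. Ireland, M. Rosen, *A Classical Introduction to Modern Number Theory*, 2nd ed.,
  GTM 84, Ch. 8 §§3, 7 (the counts `N_p(a)` for `x³ + 2y³`).
* [HeathBrownMoroz2004] D. R. Heath-Brown, B. Z. Moroz, Proc. LMS (3) 88 (2004), §2 (2.3)–(2.4)
  (splitting `#𝒜_q` over residue pairs), Lemma 2.4 (the local counts).

## Mathlib / tree search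

Tree: `pairZeroCount(_prime/_le/_eq_card_zmod)`, `abs_card_Ioc_filter_modEq_sub_le`, `classBoxPairs`,
`seqPairBox`, `abs_remainder_seqPairBox_le`, `exists_sum_abs_remainder_seqPairBox_le`,
`hasSieveDimension_pairClassDensity`, `densityProduct_seqPairBox_nonneg` (`CubicFormClassBrunTitchmarsh`);
`cubicPairCount(_zero/_eq_of_not_dvd)`, `abs_cubicPairCount_sub_le` (`CubicFormLocalCount`);
`cubeRootTwoCount_two/_three/_five/_le_three`; `CubicSieve.hasSieveDimension_of_le_div`;
`SieveSequence.fundamental_lemma_uniform_holds`; `exists_sum_sigma_zero_pow_le_real` (`DivisorPowerSums`).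
Mathlib: `ZMod.chineseRemainder`, `ZMod.natCast_mod`, `ZMod.natCast_eq_zero_iff`, `Finset.filter_product`,
`Finset.card_eq_sum_card_fiberwise`, `Finset.filter_or`, `Finset.card_union_of_disjoint`.
`Real.summable_one_div_nat_rpow`, `Summable.sum_le_tsum`, `Real.add_one_le_exp`, `Real.exp_sum`.
`lean search 'twoClassCount|twoClassDensity|pairBox|localFactorConst'`: nothing before this file.
-/

noncomputable section

open Finset Filter Topology
open scoped ArithmeticFunction.sigma

namespace Literature.NumberTheory.Sieve.CubicPrimes

open CubicSieve (hasSieveDimension_of_le_div)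

/-! ### The local two-class count `Ω_n(q)` -/

/-- `Ω_n(q) = #{(u, w) mod q : (u³ + 2w³)(n − (u³ + 2w³)) ≡ 0 (mod q)}` — the number of classes of pairs
removed by the two-class sieve at a square-free `q` (for a prime: `v ≡ 0` or `v ≡ n`); junk `0` at `q = 0`.
[cite: HalberstamRichert1974, Ch. 2 §8 (the polynomial `a(n − a)` of a binary problem)] -/
def twoClassCount (n q : ℕ) : ℕ :=
  #{uw ∈ range q ×ˢ range q |
    (((uw.1 ^ 3 + 2 * uw.2 ^ 3 : ℕ) : ZMod q) * ((n : ZMod q) - ((uw.1 ^ 3 + 2 * uw.2 ^ 3 : ℕ) : ZMod q))) = 0}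

/-- `Ω_n(q)` counted in `(ℤ/qℤ)²`. [cite: HalberstamRichert1974, Ch. 2 §8 (the polynomial `a(n − a)` of a binary problem)] -/
theorem twoClassCount_eq_card_zmod (n q : ℕ) [NeZero q] :
    twoClassCount n q =
      #{v : ZMod q × ZMod q | (v.1 ^ 3 + 2 * v.2 ^ 3) * ((n : ZMod q) - (v.1 ^ 3 + 2 * v.2 ^ 3)) = 0} := by
  classical
  rw [twoClassCount]
  refine Finset.card_nbij' (fun uw => ((uw.1 : ZMod q), (uw.2 : ZMod q)))
    (fun v => (v.1.val, v.2.val)) ?_ ?_ ?_ ?_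
  · intro uw huw
    rw [mem_coe, mem_filter, mem_product, mem_range, mem_range] at huw
    simp only [mem_coe, mem_filter, mem_univ, true_and]
    have h := huw.2
    push_cast at h
    exact h
  · intro v hv
    simp only [mem_coe, mem_filter, mem_univ, true_and] at hv
    rw [mem_coe, mem_filter, mem_product, mem_range, mem_range]
    refine ⟨⟨ZMod.val_lt v.1, ZMod.val_lt v.2⟩, ?_⟩
    push_cast
    rw [ZMod.natCast_zmod_val, ZMod.natCast_zmod_val]
    exact hv
  · intro uw huw
    rw [mem_coe, mem_filter, mem_product, mem_range, mem_range] at huw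
    simp only [ZMod.val_natCast_of_lt huw.1.1, ZMod.val_natCast_of_lt huw.1.2]
  · intro v _
    simp only [ZMod.natCast_zmod_val]

/-- **`Ω_n(p) = ω(p)` for `p ∣ n`**: then `v(n − v) ≡ −v²`, and only `v ≡ 0` is removed.
[cite: HalberstamRichert1974, Ch. 2 §8 (the polynomial `a(n − a)` of a binary problem)] -/
theorem twoClassCount_prime_of_dvd {n p : ℕ} (hp : p.Prime) (hpn : p ∣ n) :
    twoClassCount n p = pairZeroCount p := by
  classical
  haveI := Fact.mk hp
  rw [twoClassCount_eq_card_zmod, pairZeroCount_eq_card_zmod]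
  have hn0 : (n : ZMod p) = 0 := (ZMod.natCast_eq_zero_iff n p).mpr hpn
  congr 1
  ext v
  simp only [mem_filter, mem_univ, true_and, hn0, zero_sub, mul_neg, neg_eq_zero, mul_self_eq_zero]

/-- **`Ω_n(p) = ω(p) + N_p(n)` for `p ∤ n`**: the classes `v ≡ 0` and `v ≡ n` are disjoint.
[cite: HalberstamRichert1974, Ch. 2 §8 (the polynomial `a(n − a)` of a binary problem)] -/
theorem twoClassCount_prime_of_not_dvd {n p : ℕ} (hp : p.Prime) (hpn : ¬ p ∣ n) :
    haveI := Fact.mk hp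
    twoClassCount n p = pairZeroCount p + cubicPairCount (n : ZMod p) := by
  classical
  haveI := Fact.mk hp
  rw [twoClassCount_eq_card_zmod, pairZeroCount_eq_card_zmod, cubicPairCount_def]
  have hn0 : (n : ZMod p) ≠ 0 := fun h => hpn ((ZMod.natCast_eq_zero_iff n p).mp h)
  have hset : (univ.filter fun v : ZMod p × ZMod p =>
      (v.1 ^ 3 + 2 * v.2 ^ 3) * ((n : ZMod p) - (v.1 ^ 3 + 2 * v.2 ^ 3)) = 0) =
      (univ.filter fun v : ZMod p × ZMod p => v.1 ^ 3 + 2 * v.2 ^ 3 = 0) ∪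
        (univ.filter fun v : ZMod p × ZMod p => v.1 ^ 3 + 2 * v.2 ^ 3 = n) := by
    ext v
    simp only [mem_filter, mem_univ, true_and, mem_union, mul_eq_zero, sub_eq_zero]
    constructor
    · rintro (h | h)
      · exact Or.inl h
      · exact Or.inr h.symm
    · rintro (h | h)
      · exact Or.inl h
      · exact Or.inr h.symm
  rw [hset, card_union_of_disjoint]
  rw [disjoint_filter]
  intro v _ h0 hn
  exact hn0 (hn ▸ h0)

/-- `Ω_n(1) = 1`. [cite: HalberstamRichert1974, Ch. 2 §8 (the polynomial `a(n − a)` of a binary problem)] -/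
theorem twoClassCount_one (n : ℕ) : twoClassCount n 1 = 1 := by
  rw [twoClassCount]
  have : (range 1 ×ˢ range 1 : Finset (ℕ × ℕ)) = {(0, 0)} := by decide
  rw [this]
  rw [card_eq_one]
  refine ⟨(0, 0), ?_⟩
  ext uw
  simp only [mem_filter, mem_singleton]
  constructor
  · exact fun h => h.1
  · intro h; exact ⟨h, Subsingleton.elim _ _⟩

/-- **`Ω_n` is multiplicative in `q`** (Chinese remainder theorem in both coordinates).
[cite: HalberstamRichert1974, Ch. 2 §8 (the polynomial `a(n − a)` of a binary problem)] -/
theorem twoClassCount_mul (n : ℕ) {m k : ℕ} (hm : m ≠ 0) (hk : k ≠ 0) (h : m.Coprime k) :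
    twoClassCount n (m * k) = twoClassCount n m * twoClassCount n k := by
  classical
  haveI : NeZero m := ⟨hm⟩
  haveI : NeZero k := ⟨hk⟩
  haveI : NeZero (m * k) := ⟨mul_ne_zero hm hk⟩
  rw [twoClassCount_eq_card_zmod, twoClassCount_eq_card_zmod, twoClassCount_eq_card_zmod, ← card_product]
  set ψ := ZMod.chineseRemainder h with hψ
  have hψn : ψ (n : ZMod (m * k)) = ((n : ZMod m), (n : ZMod k)) := by
    rw [map_natCast]; rfl
  refine card_nbij' (fun v => (((ψ v.1).1, (ψ v.2).1), ((ψ v.1).2, (ψ v.2).2)))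
    (fun w => (ψ.symm (w.1.1, w.2.1), ψ.symm (w.1.2, w.2.2))) ?_ ?_ ?_ ?_
  · intro v hv
    simp only [mem_coe, mem_filter, mem_univ, true_and] at hv
    simp only [mem_coe, mem_product, mem_filter, mem_univ, true_and]
    have key : ψ ((v.1 ^ 3 + 2 * v.2 ^ 3) * ((n : ZMod (m * k)) - (v.1 ^ 3 + 2 * v.2 ^ 3))) = 0 := by
      rw [hv, map_zero]
    rw [map_mul, map_sub, map_add, map_mul, map_pow, map_pow, map_ofNat, hψn] at key
    have k1 := congr_arg Prod.fst key
    have k2 := congr_arg Prod.snd key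
    simp only [Prod.fst_add, Prod.fst_mul, Prod.pow_fst, Prod.fst_ofNat, Prod.fst_zero, Prod.fst_sub,
      Prod.snd_add, Prod.snd_mul, Prod.pow_snd, Prod.snd_ofNat, Prod.snd_zero, Prod.snd_sub] at k1 k2
    exact ⟨k1, k2⟩
  · intro w hw
    simp only [mem_coe, mem_product, mem_filter, mem_univ, true_and] at hw
    simp only [mem_coe, mem_filter, mem_univ, true_and]
    apply ψ.injective
    rw [map_mul, map_sub, map_add, map_mul, map_pow, map_pow, map_ofNat, map_zero, hψn,
      RingEquiv.apply_symm_apply, RingEquiv.apply_symm_apply]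
    ext
    · simp only [Prod.fst_add, Prod.fst_mul, Prod.pow_fst, Prod.fst_ofNat, Prod.fst_zero, Prod.fst_sub]
      exact hw.1
    · simp only [Prod.snd_add, Prod.snd_mul, Prod.pow_snd, Prod.snd_ofNat, Prod.snd_zero, Prod.snd_sub]
      exact hw.2
  · intro v _
    simp only [Prod.mk.eta, RingEquiv.symm_apply_apply]
  · intro w _
    simp only [RingEquiv.apply_symm_apply, Prod.mk.eta]

/-- `Ω_n` of a product of distinct primes. [cite: HalberstamRichert1974, Ch. 2 §8 (the polynomial `a(n − a)` of a binary problem)] -/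
theorem twoClassCount_prod_primes (n : ℕ) {s : Finset ℕ} (hs : ∀ p ∈ s, p.Prime) :
    twoClassCount n (∏ p ∈ s, p) = ∏ p ∈ s, twoClassCount n p := by
  classical
  induction s using Finset.induction_on with
  | empty => simp [twoClassCount_one]
  | insert a s ha ih =>
    have hsa : ∀ p ∈ s, p.Prime := fun p hp => hs p (mem_insert_of_mem hp)
    have hap : a.Prime := hs a (mem_insert_self a s)
    rw [prod_insert ha, prod_insert ha]
    have hcop : a.Coprime (∏ p ∈ s, p) :=
      Nat.Coprime.prod_right fun p hp => (Nat.coprime_primes hap (hsa p hp)).mpr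
        (fun h => ha (h ▸ hp))
    have hne : (∏ p ∈ s, p) ≠ 0 := prod_ne_zero_iff.mpr fun p hp => (hsa p hp).ne_zero
    rw [twoClassCount_mul n hap.ne_zero hne hcop, ih hsa]

/-- `Ω_n(q) = ∏_{p∣q} Ω_n(p)` for square-free `q`. [cite: HalberstamRichert1974, Ch. 2 §8 (the polynomial `a(n − a)` of a binary problem)] -/
theorem twoClassCount_of_squarefree (n : ℕ) {q : ℕ} (hq : Squarefree q) :
    twoClassCount n q = ∏ p ∈ q.primeFactors, twoClassCount n p := by
  conv_lhs => rw [← Nat.prod_primeFactors_of_squarefree hq]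
  exact twoClassCount_prod_primes n fun p hp => Nat.prime_of_mem_primeFactors hp

/-- `N_p(a) ≤ 2p + 1` for `a ≢ 0` (`= p` if `3 ∤ p − 1`; else Hasse `≤ p + 1 − ν_p + 2√p ≤ 2p + 1`).
[cite: IrelandRosen1990, Ch. 8 §7 Thm 5] -/
theorem cubicPairCount_le_two_mul_add_one {p : ℕ} [Fact p.Prime] {a : ZMod p} (ha : a ≠ 0) :
    (cubicPairCount a : ℝ) ≤ 2 * p + 1 := by
  have hp : p.Prime := Fact.out
  have hp2 : (2 : ℝ) ≤ p := by exact_mod_cast hp.two_le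
  by_cases h3 : 3 ∣ p - 1
  · have h := (abs_le.mp (abs_cubicPairCount_sub_le ha)).2
    have hν0 : (0 : ℝ) ≤ cubeRootTwoCount p := Nat.cast_nonneg _
    -- `3 ∣ p − 1` forces `p ≥ 4`, so `2√p ≤ p`
    have hp4 : (4 : ℝ) ≤ p := by
      have : 4 ≤ p := by
        rcases h3 with ⟨c, hc⟩
        have := hp.two_le
        omega
      exact_mod_cast this
    have hsqrt : 2 * Real.sqrt p ≤ p := by
      have hs0 : 0 ≤ Real.sqrt p := Real.sqrt_nonneg _
      have hss : Real.sqrt p * Real.sqrt p = p := Real.mul_self_sqrt (by linarith)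
      nlinarith
    linarith
  · rw [cubicPairCount_eq_of_not_dvd h3]
    linarith

/-- **`Ω_n(p) ≤ 5p`** at every prime: `ω(p) ≤ 3p − 2` and `N_p(n) ≤ 2p + 1`.
[cite: HalberstamRichert1974, Ch. 2 §8 (the polynomial `a(n − a)` of a binary problem)] -/
theorem twoClassCount_prime_le {n p : ℕ} (hp : p.Prime) : (twoClassCount n p : ℝ) ≤ 5 * p := by
  haveI := Fact.mk hp
  have hω := pairZeroCount_le hp
  have hp1 : (1 : ℝ) ≤ p := by exact_mod_cast hp.one_le
  by_cases hpn : p ∣ n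
  · rw [twoClassCount_prime_of_dvd hp hpn]; linarith
  · rw [twoClassCount_prime_of_not_dvd hp hpn, Nat.cast_add]
    have hn0 : (n : ZMod p) ≠ 0 := fun h => hpn ((ZMod.natCast_eq_zero_iff n p).mp h)
    have hN := cubicPairCount_le_two_mul_add_one hn0
    linarith

/-- `Ω_n(q) ≤ τ(q)³ · q` for square-free `q` (`Ω_n(p) ≤ 5p ≤ 8p`, `8^{#primes} = τ(q)³`).
[cite: HalberstamRichert1974, Ch. 2 §8 (the polynomial `a(n − a)` of a binary problem)] -/
theorem twoClassCount_le_card_divisors_pow_mul (n : ℕ) {q : ℕ} (hq : Squarefree q) :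
    (twoClassCount n q : ℝ) ≤ (#q.divisors : ℝ) ^ 3 * q := by
  have hq0 : q ≠ 0 := hq.ne_zero
  rw [twoClassCount_of_squarefree n hq, Nat.cast_prod]
  have hτ : (#q.divisors : ℝ) = ∏ p ∈ q.primeFactors, (2 : ℝ) := by
    have h := (ArithmeticFunction.isMultiplicative_sigma (k := 0)).multiplicative_factorization
      (ArithmeticFunction.sigma 0) hq0
    rw [ArithmeticFunction.sigma_zero_apply] at h
    rw [h, Finsupp.prod, Nat.support_factorization, Nat.cast_prod]
    refine prod_congr rfl fun p hp => ?_
    have hpp : p.Prime := Nat.prime_of_mem_primeFactors hp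
    have h1 : q.factorization p = 1 := by
      have hle := hq.natFactorization_le_one p
      have hpos : 0 < q.factorization p := hpp.factorization_pos_of_dvd hq0 (Nat.dvd_of_mem_primeFactors hp)
      omega
    rw [h1, pow_one, ArithmeticFunction.sigma_zero_apply, hpp.divisors]
    have : #({1, p} : Finset ℕ) = 2 := card_pair hpp.one_lt.ne
    rw [this]; norm_num
  rw [hτ, ← prod_pow, ← Nat.prod_primeFactors_of_squarefree hq, Nat.cast_prod,
    Nat.prod_primeFactors_of_squarefree hq, ← prod_mul_distrib]
  refine prod_le_prod (fun p _ => Nat.cast_nonneg _) fun p hp => ?_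
  have hpp : p.Prime := Nat.prime_of_mem_primeFactors hp
  have h2 : (2 : ℝ) ≤ p := by exact_mod_cast hpp.two_le
  calc (twoClassCount n p : ℝ) ≤ 5 * p := twoClassCount_prime_le hpp
    _ ≤ 2 ^ 3 * p := by nlinarith

/-! ### The two-class density and its sieve dimension (even `n`) -/

/-- The multiplicative density of the two-class pair sieve: `g_n(q) = ∏_{p∣q} Ω_n(p)/p²`.
[cite: HalberstamRichert1974, Ch. 2 §8 (the polynomial `a(n − a)` of a binary problem)] -/
def twoClassDensity (n : ℕ) : ArithmeticFunction ℝ :=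
  ArithmeticFunction.prodPrimeFactors fun p => (twoClassCount n p : ℝ) / (p : ℝ) ^ 2

/-- `g_n` is multiplicative. [cite: HalberstamRichert1974, Ch. 2 §8 (the polynomial `a(n − a)` of a binary problem)] -/
theorem isMultiplicative_twoClassDensity (n : ℕ) : (twoClassDensity n).IsMultiplicative :=
  ArithmeticFunction.IsMultiplicative.prodPrimeFactors _

/-- `g_n(q)` for `q ≠ 0`. [cite: HalberstamRichert1974, Ch. 2 §8 (the polynomial `a(n − a)` of a binary problem)] -/
theorem twoClassDensity_apply (n : ℕ) {q : ℕ} (hq : q ≠ 0) :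
    twoClassDensity n q = ∏ p ∈ q.primeFactors, (twoClassCount n p : ℝ) / (p : ℝ) ^ 2 := by
  rw [twoClassDensity, ArithmeticFunction.prodPrimeFactors_apply hq]

/-- `g_n(p)` at a prime. [cite: HalberstamRichert1974, Ch. 2 §8 (the polynomial `a(n − a)` of a binary problem)] -/
theorem twoClassDensity_prime (n : ℕ) {p : ℕ} (hp : p.Prime) :
    twoClassDensity n p = (twoClassCount n p : ℝ) / (p : ℝ) ^ 2 := by
  rw [twoClassDensity_apply n hp.ne_zero, hp.primeFactors, prod_singleton]

/-- `g_n(q) = Ω_n(q)/q²` for square-free `q`. [cite: HalberstamRichert1974, Ch. 2 §8 (the polynomial `a(n − a)` of a binary problem)] -/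
theorem twoClassDensity_eq_of_squarefree (n : ℕ) {q : ℕ} (hq : Squarefree q) :
    twoClassDensity n q = (twoClassCount n q : ℝ) / (q : ℝ) ^ 2 := by
  have hq0 : q ≠ 0 := hq.ne_zero
  rw [twoClassDensity_apply n hq0, twoClassCount_of_squarefree n hq, Nat.cast_prod]
  have hden : (∏ x ∈ q.primeFactors, (x : ℝ)) = q := by
    rw [← Nat.cast_prod, Nat.prod_primeFactors_of_squarefree hq]
  rw [prod_div_distrib, prod_pow, hden]

/-- **Prime bounds of the two-class density for EVEN `n`**: `0 ≤ g_n(p) ≤ 5/p` and `g_n(p) ≤ 3/4`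
(`p = 2`: only `v ≡ 0` since `2 ∣ n`, `g = 1/2`; `p = 3, 5`: `Ω = 2p`; `p ≥ 7`: `Ω ≤ 5p ≤ (3/4)p²`).
[cite: HalberstamRichert1974, Ch. 2 §8 (the polynomial `a(n − a)` of a binary problem)] -/
theorem twoClassDensity_prime_bounds {n : ℕ} (hn : Even n) {p : ℕ} (hp : p.Prime) :
    0 ≤ twoClassDensity n p ∧ twoClassDensity n p ≤ 5 / p ∧ twoClassDensity n p ≤ 1 - 1 / 4 := by
  haveI := Fact.mk hp
  rw [twoClassDensity_prime n hp]
  have hp2 : (2 : ℝ) ≤ p := by exact_mod_cast hp.two_le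
  have hΩ := twoClassCount_prime_le (n := n) hp
  have hΩ0 : (0 : ℝ) ≤ twoClassCount n p := Nat.cast_nonneg _
  refine ⟨by positivity, ?_, ?_⟩
  · rw [div_le_div_iff₀ (by positivity) (by positivity)]
    nlinarith
  · rw [div_le_iff₀ (by positivity)]
    by_cases h7 : 7 ≤ p
    · have h7' : (7 : ℝ) ≤ p := by exact_mod_cast h7
      nlinarith
    · have hp' : p = 2 ∨ p = 3 ∨ p = 5 := by
        have := hp.two_le
        interval_cases p <;> simp_all (config := {decide := true})
      rcases hp' with rfl | rfl | rfl
      · -- `p = 2 ∣ n`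
        rw [twoClassCount_prime_of_dvd hp (even_iff_two_dvd.mp hn), pairZeroCount_prime_real hp,
          cubeRootTwoCount_two]
        norm_num
      · have hω : (pairZeroCount 3 : ℝ) = 3 := by
          rw [pairZeroCount_prime_real hp, cubeRootTwoCount_three]; norm_num
        by_cases h3n : 3 ∣ n
        · rw [twoClassCount_prime_of_dvd hp h3n, hω]; norm_num
        · rw [twoClassCount_prime_of_not_dvd hp h3n, Nat.cast_add, hω,
            cubicPairCount_eq_of_not_dvd (by norm_num)]
          norm_num
      · have hω : (pairZeroCount 5 : ℝ) = 5 := by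
          rw [pairZeroCount_prime_real hp, cubeRootTwoCount_five]; norm_num
        by_cases h5n : 5 ∣ n
        · rw [twoClassCount_prime_of_dvd hp h5n, hω]; norm_num
        · rw [twoClassCount_prime_of_not_dvd hp h5n, Nat.cast_add, hω,
            cubicPairCount_eq_of_not_dvd (by norm_num)]
          norm_num

/-- The dimension constant of the two-class pair sieve (`Ω(5)`, `δ = 1/4`). [folklore] -/
def twoClassDimConst : ℝ := Real.exp (5 * (9 / 2 + 6 / Real.log 2) + 5 ^ 2 / (1 / 4))

/-- **For even `n` the two-class density satisfies `Ω(5)` with the absolute constant `twoClassDimConst`.**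
[cite: HalberstamRichert1974, Ch. 2 §8 (the polynomial `a(n − a)` of a binary problem)] -/
theorem hasSieveDimension_twoClassDensity {n : ℕ} (hn : Even n) :
    HasSieveDimension (twoClassDensity n) 5 twoClassDimConst := by
  have h := hasSieveDimension_of_le_div (g := twoClassDensity n) (A := 5) (δ := 1 / 4) (by norm_num)
    (fun p hp => twoClassDensity_prime_bounds hn hp)
  simpa [twoClassDimConst] using h

/-! ### The box, the values and the sifted sequence -/

/-- The box of pairs `(A, A+L] × (A', A'+L]`. [cite: HalberstamRichert1974, Ch. 2 §8 (the polynomial `a(n − a)` of a binary problem)] -/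
def pairBox (A A' L : ℕ) : Finset (ℕ × ℕ) := Ioc A (A + L) ×ˢ Ioc A' (A' + L)

/-- The value `v = x³ + 2y³` of a pair. [cite: HeathBrownMoroz2004, §1 (1.1)] -/
def pairValue (xy : ℕ × ℕ) : ℕ := xy.1 ^ 3 + 2 * xy.2 ^ 3

/-- `pairValue` unfolded. [cite: HeathBrownMoroz2004, §1 (1.1)] -/
theorem pairValue_def (xy : ℕ × ℕ) : pairValue xy = xy.1 ^ 3 + 2 * xy.2 ^ 3 := rfl

/-- On the box the values are positive and, under `(A+L)³ + 2(A'+L)³ < n`, below `n`.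
[cite: HeathBrownMoroz2004, §1 (1.1)] -/
theorem pairValue_pos_lt {A A' L n : ℕ} (htop : (A + L) ^ 3 + 2 * (A' + L) ^ 3 < n) {xy : ℕ × ℕ}
    (hxy : xy ∈ pairBox A A' L) : 0 < pairValue xy ∧ pairValue xy < n := by
  rw [pairBox, mem_product, mem_Ioc, mem_Ioc] at hxy
  obtain ⟨⟨hx1, hx2⟩, -, hy2⟩ := hxy
  rw [pairValue]
  constructor
  · have : 0 < xy.1 := by omega
    positivity
  · calc xy.1 ^ 3 + 2 * xy.2 ^ 3 ≤ (A + L) ^ 3 + 2 * (A' + L) ^ 3 := by gcongr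
      _ < n := htop

/-- **The two-class sifted sequence**: weights `a_k = #{(x,y) in the box : v(n − v) = k}`, size `L²`,
density `g_n` (so `𝒜_q` counts the pairs with `q ∣ v(n−v)`).
[cite: HalberstamRichert1974, Ch. 2 §8 (the polynomial `a(n − a)` of a binary problem)] -/
def seqTwoClass (A A' L n : ℕ) : SieveSequence where
  a k := (#{xy ∈ pairBox A A' L | pairValue xy * (n - pairValue xy) = k} : ℝ)
  a_nonneg _ := Nat.cast_nonneg _
  size _ := (L : ℝ) ^ 2
  density := twoClassDensity n
  density_mult := isMultiplicative_twoClassDensity n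

/-- The sifted values lie in `(0, n²]`. [cite: HalberstamRichert1974, Ch. 2 §8 (the polynomial `a(n − a)` of a binary problem)] -/
theorem twoClassValue_mem_Ioc {A A' L n : ℕ} (htop : (A + L) ^ 3 + 2 * (A' + L) ^ 3 < n) {xy : ℕ × ℕ}
    (hxy : xy ∈ pairBox A A' L) : pairValue xy * (n - pairValue xy) ∈ Ioc 0 (n ^ 2) := by
  obtain ⟨h0, hlt⟩ := pairValue_pos_lt htop hxy
  rw [mem_Ioc]
  constructor
  · exact Nat.mul_pos h0 (by omega)
  · calc pairValue xy * (n - pairValue xy) ≤ n * n := Nat.mul_le_mul hlt.le (Nat.sub_le n _)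
      _ = n ^ 2 := (sq n).symm

/-- Sums of the sequence over a set of integers count pairs. [cite: HalberstamRichert1974, Ch. 2 §8 (the polynomial `a(n − a)` of a binary problem)] -/
theorem sum_seqTwoClass_a_filter {A A' L n : ℕ} (htop : (A + L) ^ 3 + 2 * (A' + L) ^ 3 < n)
    (c : ℕ → Prop) [DecidablePred c] :
    ∑ k ∈ (Ioc 0 (n ^ 2)).filter c, (seqTwoClass A A' L n).a k =
      #{xy ∈ pairBox A A' L | c (pairValue xy * (n - pairValue xy))} := by
  classical
  have hmaps : Set.MapsTo (fun xy : ℕ × ℕ => pairValue xy * (n - pairValue xy))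
      ({xy ∈ pairBox A A' L | c (pairValue xy * (n - pairValue xy))} : Finset (ℕ × ℕ))
      ((Ioc 0 (n ^ 2)).filter c) := by
    intro xy hxy
    rw [mem_coe, mem_filter] at hxy ⊢
    exact ⟨twoClassValue_mem_Ioc htop hxy.1, hxy.2⟩
  rw [card_eq_sum_card_fiberwise hmaps, Nat.cast_sum]
  refine sum_congr rfl fun k hk => ?_
  simp only [seqTwoClass, filter_filter]
  congr 2
  ext xy
  simp only [mem_filter, and_congr_right_iff]
  intro _
  constructor
  · rintro rfl; exact ⟨(mem_filter.mp hk).2, rfl⟩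
  · rintro ⟨-, rfl⟩; rfl

/-- **`S(𝒜, z)` is the two-class count `T(z)`**: a pair is counted iff both `v` and `n − v` are coprime
to `P(z)`. [cite: HalberstamRichert1974, Ch. 2 §8 (the polynomial `a(n − a)` of a binary problem)] -/
theorem sifted_seqTwoClass_eq {A A' L n : ℕ} (htop : (A + L) ^ 3 + 2 * (A' + L) ^ 3 < n) (z : ℝ) :
    (seqTwoClass A A' L n).sifted ((n ^ 2 : ℕ) : ℝ) (primesProdBelow z) =
      #{xy ∈ pairBox A A' L | (pairValue xy).Coprime (primesProdBelow z) ∧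
        (n - pairValue xy).Coprime (primesProdBelow z)} := by
  rw [SieveSequence.sifted, Nat.floor_natCast, sum_seqTwoClass_a_filter htop]
  have hset : (pairBox A A' L).filter
      (fun xy => (pairValue xy * (n - pairValue xy)).Coprime (primesProdBelow z)) =
      (pairBox A A' L).filter (fun xy => (pairValue xy).Coprime (primesProdBelow z) ∧
        (n - pairValue xy).Coprime (primesProdBelow z)) :=
    filter_congr fun xy _ => Nat.coprime_mul_iff_left
  rw [hset]

/-- `𝒜_q = #{(x,y) in the box : q ∣ v(n − v)}`. [cite: HalberstamRichert1974, Ch. 2 §8 (the polynomial `a(n − a)` of a binary problem)] -/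
theorem congrSum_seqTwoClass_eq {A A' L n : ℕ} (htop : (A + L) ^ 3 + 2 * (A' + L) ^ 3 < n) (q : ℕ) :
    (seqTwoClass A A' L n).congrSum q ((n ^ 2 : ℕ) : ℝ) =
      #{xy ∈ pairBox A A' L | q ∣ pairValue xy * (n - pairValue xy)} := by
  rw [SieveSequence.congrSum, Nat.floor_natCast, sum_seqTwoClass_a_filter htop]

/-! ### The Type-I estimate (trivial lattice counts) -/

/-- The removed residue pairs modulo `q`. [cite: HalberstamRichert1974, Ch. 2 §8 (the polynomial `a(n − a)` of a binary problem)] -/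
private def twoClassPairsMod (n q : ℕ) : Finset (ℕ × ℕ) :=
  {uw ∈ range q ×ˢ range q |
    (((uw.1 ^ 3 + 2 * uw.2 ^ 3 : ℕ) : ZMod q) * ((n : ZMod q) - ((uw.1 ^ 3 + 2 * uw.2 ^ 3 : ℕ) : ZMod q))) = 0}

/-- `#twoClassPairsMod n q = Ω_n(q)` (private helper). [folklore] -/
private theorem card_twoClassPairsMod (n q : ℕ) : #(twoClassPairsMod n q) = twoClassCount n q := rfl

/-- For a pair with `v < n`: `q ∣ v(n − v)` iff `(v̄)(n̄ − v̄) = 0` in `ℤ/q` with `v̄` computed from the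
residues `(x mod q, y mod q)`. [folklore] -/
private theorem dvd_twoClassValue_iff {n q : ℕ} {xy : ℕ × ℕ} (hv : pairValue xy < n) :
    q ∣ pairValue xy * (n - pairValue xy) ↔
      ((((xy.1 % q) ^ 3 + 2 * (xy.2 % q) ^ 3 : ℕ) : ZMod q) *
        ((n : ZMod q) - (((xy.1 % q) ^ 3 + 2 * (xy.2 % q) ^ 3 : ℕ) : ZMod q))) = 0 := by
  rw [← ZMod.natCast_eq_zero_iff, Nat.cast_mul, Nat.cast_sub hv.le, pairValue]
  push_cast
  rw [ZMod.natCast_mod, ZMod.natCast_mod]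

/-- **Splitting `#𝒜_q` over the removed residue pairs.** [cite: HeathBrownMoroz2004, §2 (2.3)–(2.4)] -/
private theorem card_filter_dvd_twoClass_eq_sum {A A' L n q : ℕ} (hq : 0 < q)
    (htop : (A + L) ^ 3 + 2 * (A' + L) ^ 3 < n) :
    #{xy ∈ pairBox A A' L | q ∣ pairValue xy * (n - pairValue xy)} =
      ∑ uw ∈ twoClassPairsMod n q,
        #{x ∈ Ioc A (A + L) | x ≡ uw.1 [MOD q]} * #{y ∈ Ioc A' (A' + L) | y ≡ uw.2 [MOD q]} := by
  classical
  have hmaps : Set.MapsTo (fun xy : ℕ × ℕ => (xy.1 % q, xy.2 % q))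
      ({xy ∈ pairBox A A' L | q ∣ pairValue xy * (n - pairValue xy)} : Finset (ℕ × ℕ))
      (twoClassPairsMod n q) := by
    intro xy hxy
    rw [mem_coe, mem_filter] at hxy
    rw [mem_coe, twoClassPairsMod, mem_filter, mem_product, mem_range, mem_range]
    exact ⟨⟨Nat.mod_lt _ hq, Nat.mod_lt _ hq⟩,
      (dvd_twoClassValue_iff (pairValue_pos_lt htop hxy.1).2).mp hxy.2⟩
  rw [card_eq_sum_card_fiberwise hmaps]
  refine sum_congr rfl fun uw huw => ?_
  obtain ⟨u, w⟩ := uw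
  rw [twoClassPairsMod, mem_filter, mem_product, mem_range, mem_range] at huw
  obtain ⟨⟨hu, hw⟩, hzero⟩ := huw
  rw [← card_product, ← filter_product]
  congr 1
  ext ⟨x, y⟩
  simp only [mem_filter, pairBox, mem_product, mem_Ioc, Prod.mk.injEq, Nat.ModEq,
    Nat.mod_eq_of_lt hu, Nat.mod_eq_of_lt hw]
  constructor
  · rintro ⟨⟨⟨hx, hy⟩, -⟩, hxu, hyw⟩
    exact ⟨⟨hx, hy⟩, hxu, hyw⟩
  · rintro ⟨⟨hx, hy⟩, hxu, hyw⟩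
    refine ⟨⟨⟨hx, hy⟩, ?_⟩, hxu, hyw⟩
    have hmem : (x, y) ∈ pairBox A A' L := by
      rw [pairBox, mem_product, mem_Ioc, mem_Ioc]; exact ⟨hx, hy⟩
    rw [dvd_twoClassValue_iff (pairValue_pos_lt htop hmem).2]
    simp only [hxu, hyw]
    exact hzero

/-- Product of two counts each within `1` of `t ≥ 0`: `|n₁ n₂ − t²| ≤ 2t + 1` (private copy). [folklore] -/
private theorem abs_mul_sub_sq_le' {n₁ n₂ t : ℝ} (h₁ : |n₁ - t| ≤ 1) (h₂ : |n₂ - t| ≤ 1) (ht : 0 ≤ t) :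
    |n₁ * n₂ - t ^ 2| ≤ 2 * t + 1 := by
  have e : n₁ * n₂ - t ^ 2 = (n₁ - t) * (n₂ - t) + t * (n₁ - t) + t * (n₂ - t) := by ring
  rw [e]
  have h3 : |(n₁ - t) * (n₂ - t)| ≤ 1 := by
    rw [abs_mul]
    calc |n₁ - t| * |n₂ - t| ≤ 1 * 1 := mul_le_mul h₁ h₂ (abs_nonneg _) zero_le_one
      _ = 1 := one_mul 1
  have h4 : |t * (n₁ - t)| ≤ t := by
    rw [abs_mul, abs_of_nonneg ht]
    calc t * |n₁ - t| ≤ t * 1 := mul_le_mul_of_nonneg_left h₁ ht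
      _ = t := mul_one t
  have h5 : |t * (n₂ - t)| ≤ t := by
    rw [abs_mul, abs_of_nonneg ht]
    calc t * |n₂ - t| ≤ t * 1 := mul_le_mul_of_nonneg_left h₂ ht
      _ = t := mul_one t
  calc |(n₁ - t) * (n₂ - t) + t * (n₁ - t) + t * (n₂ - t)|
      ≤ |(n₁ - t) * (n₂ - t) + t * (n₁ - t)| + |t * (n₂ - t)| := abs_add_le _ _
    _ ≤ (|(n₁ - t) * (n₂ - t)| + |t * (n₁ - t)|) + |t * (n₂ - t)| := by
        gcongr; exact abs_add_le _ _
    _ ≤ 1 + t + t := by linarith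
    _ = 2 * t + 1 := by ring

/-- **Type-I for the two-class sieve**: for `q ≥ 1`, `|#𝒜_q − Ω_n(q)(L/q)²| ≤ Ω_n(q)(2L/q + 1)`.
[cite: HalberstamRichert1974, Thm 2.2 (the remainder `|R_d| ≤ 1` of an arithmetic progression)] -/
theorem abs_congrSum_seqTwoClass_sub_le {A A' L n q : ℕ} (hq : 0 < q)
    (htop : (A + L) ^ 3 + 2 * (A' + L) ^ 3 < n) :
    |(seqTwoClass A A' L n).congrSum q ((n ^ 2 : ℕ) : ℝ) -
        twoClassCount n q * ((L : ℝ) / q) ^ 2| ≤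
      twoClassCount n q * (2 * ((L : ℝ) / q) + 1) := by
  have hconst : ∀ T : ℝ, (twoClassCount n q : ℝ) * T = ∑ _uw ∈ twoClassPairsMod n q, T := fun T => by
    rw [sum_const, nsmul_eq_mul, card_twoClassPairsMod]
  rw [congrSum_seqTwoClass_eq htop, card_filter_dvd_twoClass_eq_sum hq htop, Nat.cast_sum, hconst,
    hconst, ← sum_sub_distrib]
  refine (abs_sum_le_sum_abs _ _).trans (sum_le_sum fun uw _ => ?_)
  rw [Nat.cast_mul]
  exact abs_mul_sub_sq_le' (abs_card_Ioc_filter_modEq_sub_le hq A L uw.1)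
    (abs_card_Ioc_filter_modEq_sub_le hq A' L uw.2) (by positivity)

/-- **The remainders of the two-class sieve**: `|R_q| ≤ τ(q)³ (2L + q)` for square-free `q`.
[cite: HalberstamRichert1974, Thm 2.2 (the remainder `|R_d| ≤ 1` of an arithmetic progression)] -/
theorem abs_remainder_seqTwoClass_le {A A' L n : ℕ} (htop : (A + L) ^ 3 + 2 * (A' + L) ^ 3 < n)
    {q : ℕ} (hq : Squarefree q) :
    |(seqTwoClass A A' L n).remainder q ((n ^ 2 : ℕ) : ℝ)| ≤ (#q.divisors : ℝ) ^ 3 * (2 * (L : ℝ) + q) := by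
  have hq0 : q ≠ 0 := hq.ne_zero
  have hqpos : 0 < q := Nat.pos_of_ne_zero hq0
  rw [SieveSequence.remainder]
  change |(seqTwoClass A A' L n).congrSum q ((n ^ 2 : ℕ) : ℝ) - twoClassDensity n q * (L : ℝ) ^ 2| ≤ _
  rw [twoClassDensity_eq_of_squarefree n hq]
  have h := abs_congrSum_seqTwoClass_sub_le (A := A) (A' := A') (L := L) (n := n) hqpos htop
  have hqR : (q : ℝ) ≠ 0 := by positivity
  have e1 : (twoClassCount n q : ℝ) / (q : ℝ) ^ 2 * (L : ℝ) ^ 2 =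
      twoClassCount n q * ((L : ℝ) / q) ^ 2 := by
    field_simp
  rw [e1]
  refine h.trans ?_
  have hΩ := twoClassCount_le_card_divisors_pow_mul n hq
  have e2 : 2 * ((L : ℝ) / q) + 1 = (2 * (L : ℝ) + q) / q := by field_simp
  rw [e2]
  calc (twoClassCount n q : ℝ) * ((2 * (L : ℝ) + q) / q)
      ≤ ((#q.divisors : ℝ) ^ 3 * q) * ((2 * (L : ℝ) + q) / q) :=
        mul_le_mul_of_nonneg_right hΩ (by positivity)
    _ = (#q.divisors : ℝ) ^ 3 * (2 * (L : ℝ) + q) := by field_simp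

/-- **The remainder sum of the two-class sieve**: `∑_{q∣P(z), q≤D}|R_q| ≤ C (L + D) D (log D)^16` for
`D ≥ 2`. [cite: HalberstamRichert1974, Thm 2.2 (the remainder `|R_d| ≤ 1` of an arithmetic progression)] -/
theorem exists_sum_abs_remainder_seqTwoClass_le :
    ∃ C : ℝ, 0 < C ∧ ∀ (A A' L n : ℕ) (z D : ℝ), (A + L) ^ 3 + 2 * (A' + L) ^ 3 < n → 2 ≤ D →
      ∑ q ∈ (primesProdBelow z).divisors.filter (fun q : ℕ => (q : ℝ) ≤ D),
          |(seqTwoClass A A' L n).remainder q ((n ^ 2 : ℕ) : ℝ)| ≤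
        C * ((L : ℝ) + D) * D * Real.log D ^ 16 := by
  obtain ⟨C, hC, hsum⟩ := exists_sum_sigma_zero_pow_le_real 3
  refine ⟨2 * C, by positivity, fun A A' L n z D htop hD => ?_⟩
  have hD0 : 0 ≤ D := by linarith
  have hL0 : (0 : ℝ) ≤ L := Nat.cast_nonneg L
  have hlog : 0 ≤ Real.log D := Real.log_nonneg (by linarith)
  have hsum' : ∑ q ∈ Icc 1 ⌊D⌋₊, (#q.divisors : ℝ) ^ 3 ≤ C * D * Real.log D ^ 16 := by
    have h := hsum D hD
    simp only [ArithmeticFunction.sigma_zero_apply] at h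
    norm_num at h
    exact h
  set S := (primesProdBelow z).divisors.filter (fun q : ℕ => (q : ℝ) ≤ D) with hS
  have hmem : ∀ q ∈ S, Squarefree q ∧ (q : ℝ) ≤ D ∧ q ∈ Icc 1 ⌊D⌋₊ := by
    intro q hq
    rw [hS, mem_filter] at hq
    have hdvd := Nat.dvd_of_mem_divisors hq.1
    refine ⟨(squarefree_primesProdBelow z).squarefree_of_dvd hdvd, hq.2, ?_⟩
    rw [mem_Icc]
    exact ⟨Nat.pos_of_mem_divisors hq.1, Nat.le_floor hq.2⟩
  have hsub : S ⊆ Icc 1 ⌊D⌋₊ := fun q hq => (hmem q hq).2.2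
  have step1 : ∑ q ∈ S, |(seqTwoClass A A' L n).remainder q ((n ^ 2 : ℕ) : ℝ)| ≤
      ∑ q ∈ S, (#q.divisors : ℝ) ^ 3 * (2 * (L : ℝ) + D) := by
    refine sum_le_sum fun q hq => ?_
    obtain ⟨hsq, hqD, -⟩ := hmem q hq
    refine (abs_remainder_seqTwoClass_le htop hsq).trans ?_
    exact mul_le_mul_of_nonneg_left (by linarith) (pow_nonneg (Nat.cast_nonneg _) 3)
  have step2 : ∑ q ∈ S, (#q.divisors : ℝ) ^ 3 ≤ ∑ q ∈ Icc 1 ⌊D⌋₊, (#q.divisors : ℝ) ^ 3 :=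
    sum_le_sum_of_subset_of_nonneg hsub fun q _ _ => pow_nonneg (Nat.cast_nonneg _) 3
  have hF0 : 0 ≤ 2 * (L : ℝ) + D := by positivity
  calc ∑ q ∈ S, |(seqTwoClass A A' L n).remainder q ((n ^ 2 : ℕ) : ℝ)|
      ≤ ∑ q ∈ S, (#q.divisors : ℝ) ^ 3 * (2 * (L : ℝ) + D) := step1
    _ = (∑ q ∈ S, (#q.divisors : ℝ) ^ 3) * (2 * (L : ℝ) + D) := by rw [sum_mul]
    _ ≤ (C * D * Real.log D ^ 16) * (2 * (L : ℝ) + D) :=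
        mul_le_mul_of_nonneg_right (step2.trans hsum') hF0
    _ ≤ 2 * C * ((L : ℝ) + D) * D * Real.log D ^ 16 := by
        have : 0 ≤ C * D * Real.log D ^ 16 * D := by positivity
        nlinarith

/-! ### The two-sided Fundamental Lemma estimate -/

/-- The sieve product of the two-class pair sieve: `V_n(z) = ∏_{p<z} (1 − Ω_n(p)/p²)`.
[cite: HalberstamRichert1974, Thm 2.5 (the product `W(z)`)] -/
def twoClassProduct (z : ℝ) (n : ℕ) : ℝ :=
  ∏ p ∈ Nat.primesBelow ⌈z⌉₊, (1 - (twoClassCount n p : ℝ) / (p : ℝ) ^ 2)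

/-- `V_n(z)` is the density product of `seqTwoClass` over `P(z)`. [cite: HalberstamRichert1974, Thm 2.5 (the product `W(z)`)] -/
theorem densityProduct_seqTwoClass_eq (A A' L n : ℕ) (z : ℝ) :
    (seqTwoClass A A' L n).densityProduct (primesProdBelow z) = twoClassProduct z n := by
  rw [SieveSequence.densityProduct, primeFactors_primesProdBelow, twoClassProduct]
  refine prod_congr rfl fun p hp => ?_
  change 1 - twoClassDensity n p = _
  rw [twoClassDensity_prime n (Nat.prime_of_mem_primesBelow hp)]

/-- `0 ≤ V_n(z) ≤ 1` for even `n`. [cite: HalberstamRichert1974, Thm 2.5 (the product `W(z)`)] -/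
theorem twoClassProduct_nonneg_le_one {n : ℕ} (hn : Even n) (z : ℝ) :
    0 ≤ twoClassProduct z n ∧ twoClassProduct z n ≤ 1 := by
  have hf : ∀ p ∈ Nat.primesBelow ⌈z⌉₊, 0 ≤ 1 - (twoClassCount n p : ℝ) / (p : ℝ) ^ 2 ∧
      1 - (twoClassCount n p : ℝ) / (p : ℝ) ^ 2 ≤ 1 := by
    intro p hp
    have hpp := Nat.prime_of_mem_primesBelow hp
    have hb := twoClassDensity_prime_bounds hn hpp
    rw [twoClassDensity_prime n hpp] at hb
    constructor <;> linarith [hb.1, hb.2.2]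
  exact ⟨prod_nonneg fun p hp => (hf p hp).1, prod_le_one (fun p hp => (hf p hp).1) fun p hp => (hf p hp).2⟩

/-- **The two-class pair sieve, two-sided Fundamental Lemma form** (absolute constant, uniform in the
box and in even `n`): for `(A+L)³ + 2(A'+L)³ < n`, `2 ≤ z ≤ D`, `2 ≤ D`,
`|#{(x,y) in the box : (v, P(z)) = (n − v, P(z)) = 1} − L² V_n(z)| ≤ C(L² V_n(z) e^{−log D/log z} + (L + D) D (log D)^16)`.
[cite: HalberstamRichert1974, Thm 2.5 (Fundamental Lemma) with Thm 2.2] -/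
theorem abs_twoClassCount_box_sub_le :
    ∃ C : ℝ, 0 < C ∧ ∀ (A A' L n : ℕ) (z D : ℝ), Even n → (A + L) ^ 3 + 2 * (A' + L) ^ 3 < n →
      2 ≤ z → z ≤ D → 2 ≤ D →
      |(#{xy ∈ pairBox A A' L | (pairValue xy).Coprime (primesProdBelow z) ∧
            (n - pairValue xy).Coprime (primesProdBelow z)} : ℝ) - (L : ℝ) ^ 2 * twoClassProduct z n| ≤
        C * ((L : ℝ) ^ 2 * twoClassProduct z n * Real.exp (-(Real.log D / Real.log z)) +
          ((L : ℝ) + D) * D * Real.log D ^ 16) := by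
  obtain ⟨C₁, hC₁, hFL⟩ := SieveSequence.fundamental_lemma_uniform_holds 5 twoClassDimConst
  obtain ⟨C₂, hC₂, hR⟩ := exists_sum_abs_remainder_seqTwoClass_le
  refine ⟨max C₁ C₂, lt_max_of_lt_left hC₁, fun A A' L n z D hn htop hz hzD hD => ?_⟩
  set 𝒜 := seqTwoClass A A' L n with h𝒜
  have hsize : ∀ x, 𝒜.size x = (L : ℝ) ^ 2 := fun _ => rfl
  have hX : 0 ≤ 𝒜.size ((n ^ 2 : ℕ) : ℝ) := by rw [hsize]; positivity
  have h := hFL 𝒜 (hasSieveDimension_twoClassDensity hn) ((n ^ 2 : ℕ) : ℝ) z D hz hzD hX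
  rw [sifted_seqTwoClass_eq htop, hsize, densityProduct_seqTwoClass_eq] at h
  have hrem := hR A A' L n z D htop hD
  have hV0 := (twoClassProduct_nonneg_le_one hn z).1
  have hm1 : C₁ ≤ max C₁ C₂ := le_max_left _ _
  have hm2 : C₂ ≤ max C₁ C₂ := le_max_right _ _
  have hP0 : 0 ≤ (L : ℝ) ^ 2 * twoClassProduct z n * Real.exp (-(Real.log D / Real.log z)) := by positivity
  have hD0 : 0 ≤ D := by linarith
  have hQ0 : 0 ≤ ((L : ℝ) + D) * D * Real.log D ^ 16 := by
    have : 0 ≤ Real.log D := Real.log_nonneg (by linarith)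
    positivity
  calc _ ≤ C₁ * (L : ℝ) ^ 2 * twoClassProduct z n * Real.exp (-(Real.log D / Real.log z)) +
        ∑ q ∈ (primesProdBelow z).divisors.filter (fun q : ℕ => (q : ℝ) ≤ D),
          |𝒜.remainder q ((n ^ 2 : ℕ) : ℝ)| := h
    _ ≤ C₁ * ((L : ℝ) ^ 2 * twoClassProduct z n * Real.exp (-(Real.log D / Real.log z))) +
        C₂ * (((L : ℝ) + D) * D * Real.log D ^ 16) := by
        have e : C₁ * (L : ℝ) ^ 2 * twoClassProduct z n * Real.exp (-(Real.log D / Real.log z)) =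
            C₁ * ((L : ℝ) ^ 2 * twoClassProduct z n * Real.exp (-(Real.log D / Real.log z))) := by ring
        have e2 : C₂ * ((L : ℝ) + D) * D * Real.log D ^ 16 = C₂ * (((L : ℝ) + D) * D * Real.log D ^ 16) := by
          ring
        rw [e]
        rw [e2] at hrem
        exact add_le_add le_rfl hrem
    _ ≤ max C₁ C₂ * ((L : ℝ) ^ 2 * twoClassProduct z n * Real.exp (-(Real.log D / Real.log z))) +
        max C₁ C₂ * (((L : ℝ) + D) * D * Real.log D ^ 16) :=
        add_le_add (mul_le_mul_of_nonneg_right hm1 hP0) (mul_le_mul_of_nonneg_right hm2 hQ0)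
    _ = _ := by ring

/-! ### The one-class companion on the same box (two-sided) -/

/-- The one-class sieve product `V(z) = ∏_{p<z}(1 − ω(p)/p²)`. [cite: HalberstamRichert1974, Thm 2.5 (the product `W(z)`)] -/
def oneClassProduct (z : ℝ) : ℝ :=
  ∏ p ∈ Nat.primesBelow ⌈z⌉₊, (1 - (pairZeroCount p : ℝ) / (p : ℝ) ^ 2)

/-- The box is the class box of modulus `1`. [cite: HeathBrownMoroz2004, §1 (1.1)] -/
theorem classBoxPairs_one (A A' L : ℕ) : classBoxPairs A A' L 1 0 0 = pairBox A A' L := by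
  rw [classBoxPairs, pairBox, filter_true_of_mem fun x _ => Nat.modEq_one,
    filter_true_of_mem fun y _ => Nat.modEq_one]

/-- `V(z)` is the density product of `seqPairBox … 1 0 0`. [cite: HalberstamRichert1974, Thm 2.5 (the product `W(z)`)] -/
theorem densityProduct_seqPairBox_one_eq (A A' L : ℕ) (z : ℝ) :
    (seqPairBox A A' L 1 0 0).densityProduct (primesProdBelow z) = oneClassProduct z := by
  rw [SieveSequence.densityProduct, primeFactors_primesProdBelow, oneClassProduct]
  refine prod_congr rfl fun p hp => ?_
  have hpp := Nat.prime_of_mem_primesBelow hp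
  change 1 - pairClassDensity 1 p = _
  rw [pairClassDensity_prime 1 hpp, if_neg (fun h => hpp.ne_one (Nat.dvd_one.mp h))]

/-- **The one-class pair sieve on the box, two-sided** (absolute constant): for `2 ≤ z ≤ D`, `2 ≤ D`,
`|#{(x,y) in the box : (x³+2y³, P(z)) = 1} − L² V(z)| ≤ C(L² V(z) e^{−log D/log z} + (L + D) D (log D)⁸)`.
[cite: HalberstamRichert1974, Thm 2.5 (Fundamental Lemma) with Thm 2.2] -/
theorem abs_oneClassCount_box_sub_le :
    ∃ C : ℝ, 0 < C ∧ ∀ (A A' L : ℕ) (z D : ℝ), 2 ≤ z → z ≤ D → 2 ≤ D →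
      |(#{xy ∈ pairBox A A' L | (pairValue xy).Coprime (primesProdBelow z)} : ℝ) -
          (L : ℝ) ^ 2 * oneClassProduct z| ≤
        C * ((L : ℝ) ^ 2 * oneClassProduct z * Real.exp (-(Real.log D / Real.log z)) +
          ((L : ℝ) + D) * D * Real.log D ^ 8) := by
  obtain ⟨C₁, hC₁, hFL⟩ := SieveSequence.fundamental_lemma_uniform_holds 3 CubicSieve.dimConst
  obtain ⟨C₂, hC₂, hR⟩ := exists_sum_abs_remainder_seqPairBox_le
  refine ⟨max C₁ C₂, lt_max_of_lt_left hC₁, fun A A' L z D hz hzD hD => ?_⟩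
  set 𝒜 := seqPairBox A A' L 1 0 0 with h𝒜
  have hsize : ∀ x, 𝒜.size x = (L : ℝ) ^ 2 := fun _ => by
    change ((L : ℝ) / (1 : ℕ)) ^ 2 = _; simp
  have hX : 0 ≤ 𝒜.size (classBoxTop A A' L : ℝ) := by rw [hsize]; positivity
  have h := hFL 𝒜 (hasSieveDimension_pairClassDensity 1) (classBoxTop A A' L : ℝ) z D hz hzD hX
  rw [sifted_seqPairBox_eq, hsize, densityProduct_seqPairBox_one_eq, classBoxPairs_one] at h
  have hab : Nat.Coprime (0 ^ 3 + 2 * 0 ^ 3) 1 := Nat.coprime_one_right _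
  have hrem := hR A A' L 1 0 0 z D one_pos hab hD
  simp only [Nat.cast_one, div_one] at hrem
  have hV0 : 0 ≤ oneClassProduct z := by
    rw [← densityProduct_seqPairBox_one_eq A A' L z]; exact densityProduct_seqPairBox_nonneg A A' L 1 0 0 z
  have hm1 : C₁ ≤ max C₁ C₂ := le_max_left _ _
  have hm2 : C₂ ≤ max C₁ C₂ := le_max_right _ _
  have hD0 : 0 ≤ D := by linarith
  have hP0 : 0 ≤ (L : ℝ) ^ 2 * oneClassProduct z * Real.exp (-(Real.log D / Real.log z)) := by positivity
  have hQ0 : 0 ≤ ((L : ℝ) + D) * D * Real.log D ^ 8 := by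
    have : 0 ≤ Real.log D := Real.log_nonneg (by linarith)
    positivity
  have hfilter : (#{xy ∈ pairBox A A' L | (xy.1 ^ 3 + 2 * xy.2 ^ 3).Coprime (primesProdBelow z)} : ℝ) =
      #{xy ∈ pairBox A A' L | (pairValue xy).Coprime (primesProdBelow z)} := by
    rfl
  rw [← hfilter]
  calc _ ≤ C₁ * (L : ℝ) ^ 2 * oneClassProduct z * Real.exp (-(Real.log D / Real.log z)) +
        ∑ q ∈ (primesProdBelow z).divisors.filter (fun q : ℕ => (q : ℝ) ≤ D),
          |𝒜.remainder q (classBoxTop A A' L : ℝ)| := h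
    _ ≤ C₁ * ((L : ℝ) ^ 2 * oneClassProduct z * Real.exp (-(Real.log D / Real.log z))) +
        C₂ * (((L : ℝ) + D) * D * Real.log D ^ 8) := by
        have e : C₁ * (L : ℝ) ^ 2 * oneClassProduct z * Real.exp (-(Real.log D / Real.log z)) =
            C₁ * ((L : ℝ) ^ 2 * oneClassProduct z * Real.exp (-(Real.log D / Real.log z))) := by ring
        have e2 : C₂ * ((L : ℝ) + D) * D * Real.log D ^ 8 = C₂ * (((L : ℝ) + D) * D * Real.log D ^ 8) := by
          ring
        rw [e]
        rw [e2] at hrem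
        exact add_le_add le_rfl hrem
    _ ≤ max C₁ C₂ * ((L : ℝ) ^ 2 * oneClassProduct z * Real.exp (-(Real.log D / Real.log z))) +
        max C₁ C₂ * (((L : ℝ) + D) * D * Real.log D ^ 8) :=
        add_le_add (mul_le_mul_of_nonneg_right hm1 hP0) (mul_le_mul_of_nonneg_right hm2 hQ0)
    _ = _ := by ring

/-! ### The local factors: `(P(z)/φ(P(z))) · V_n(z) ≥ c₁ · V(z)` uniformly in even `n` (Hasse) -/

/-- `N_p(a) ≤ p + 1 + 2√p` for `a ≢ 0 (mod p)` (Hasse; for `3 ∤ p − 1` even `N_p(a) = p`).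
[cite: IrelandRosen1990, Ch. 8 §3 and §7 Thm 5] -/
theorem cubicPairCount_le_add_two_sqrt {p : ℕ} [Fact p.Prime] {a : ZMod p} (ha : a ≠ 0) :
    (cubicPairCount a : ℝ) ≤ p + 1 + 2 * Real.sqrt p := by
  have h := (abs_le.mp (abs_cubicPairCount_sub_le ha)).2
  have hν0 : (0 : ℝ) ≤ cubeRootTwoCount p := Nat.cast_nonneg _
  linarith

/-- `0 ≤ 1 − ω(p)/p² ≤ 1` and `1/2 ≤ 1 − ω(p)/p²` at every prime. [cite: HeathBrownMoroz2004, Lemma 2.4] -/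
theorem one_sub_pairZeroCount_div_bounds {p : ℕ} (hp : p.Prime) :
    1 / 2 ≤ 1 - (pairZeroCount p : ℝ) / (p : ℝ) ^ 2 ∧ 1 - (pairZeroCount p : ℝ) / (p : ℝ) ^ 2 ≤ 1 := by
  have hb := pairClassDensity_prime_bounds 1 hp
  rw [pairClassDensity_prime 1 hp, if_neg (fun h => hp.ne_one (Nat.dvd_one.mp h))] at hb
  constructor <;> linarith [hb.1, hb.2.2]

/-- `V(z) > 0`. [cite: HalberstamRichert1974, Thm 2.5 (the product `W(z)`)] -/
theorem oneClassProduct_pos (z : ℝ) : 0 < oneClassProduct z :=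
  prod_pos fun p hp => by linarith [(one_sub_pairZeroCount_div_bounds (Nat.prime_of_mem_primesBelow hp)).1]

/-- `V(z) ≤ 1`. [cite: HalberstamRichert1974, Thm 2.5 (the product `W(z)`)] -/
theorem oneClassProduct_le_one (z : ℝ) : oneClassProduct z ≤ 1 :=
  prod_le_one (fun p hp => by linarith [(one_sub_pairZeroCount_div_bounds (Nat.prime_of_mem_primesBelow hp)).1])
    fun p hp => (one_sub_pairZeroCount_div_bounds (Nat.prime_of_mem_primesBelow hp)).2

/-- **`V(z) ≫ (log z)^{−3}`**: `(K (log z/log 2)³)⁻¹ ≤ V(z)` for `z ≥ 2`, `K = CubicSieve.dimConst`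
(the `Ω(3)` condition of the one-class density). [cite: HalberstamRichert1974, Ch. 5 (5.4) (the `Ω(κ)` condition bounds `W(z)` below)] -/
theorem oneClassProduct_ge {z : ℝ} (hz : 2 ≤ z) :
    (CubicSieve.dimConst * (Real.log z / Real.log 2) ^ 3)⁻¹ ≤ oneClassProduct z := by
  have h := (hasSieveDimension_pairClassDensity 1).2 2 z le_rfl hz
  have hfilter : (Nat.primesBelow ⌈z⌉₊).filter (fun p : ℕ => (2 : ℝ) ≤ (p : ℝ)) = Nat.primesBelow ⌈z⌉₊ :=
    filter_true_of_mem fun p hp => by exact_mod_cast (Nat.prime_of_mem_primesBelow hp).two_le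
  rw [hfilter] at h
  have hprod : ∏ p ∈ Nat.primesBelow ⌈z⌉₊, (1 - pairClassDensity 1 p)⁻¹ = (oneClassProduct z)⁻¹ := by
    rw [oneClassProduct, ← prod_inv_distrib]
    refine prod_congr rfl fun p hp => ?_
    have hpp := Nat.prime_of_mem_primesBelow hp
    rw [pairClassDensity_prime 1 hpp, if_neg (fun h => hpp.ne_one (Nat.dvd_one.mp h))]
  have e3 : (Real.log z / Real.log 2) ^ (3 : ℝ) = (Real.log z / Real.log 2) ^ (3 : ℕ) := by
    rw [← Real.rpow_natCast]
    norm_num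
  rw [hprod, e3] at h
  exact inv_le_of_inv_le₀ (oneClassProduct_pos z) h

/-- `e^{−2b} ≤ 1 − b` for `0 ≤ b ≤ 1/2` (private). [folklore] -/
private theorem exp_neg_two_mul_le {b : ℝ} (hb0 : 0 ≤ b) (hb : b ≤ 1 / 2) :
    Real.exp (-(2 * b)) ≤ 1 - b := by
  have h1 : 2 * b + 1 ≤ Real.exp (2 * b) := Real.add_one_le_exp _
  have hpos : 0 < Real.exp (2 * b) := Real.exp_pos _
  rw [Real.exp_neg, inv_eq_one_div, div_le_iff₀ hpos]
  nlinarith [mul_le_mul_of_nonneg_right h1 (by linarith : (0 : ℝ) ≤ 1 - b),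
    mul_nonneg hb0 (by linarith : (0 : ℝ) ≤ 1 - 2 * b)]

/-- The polynomial inequality behind the local factor at a prime `p ≥ 11` not dividing `n` (private):
with `s = √p`, `ω ≤ 3p − 2`, `N ≤ p + 1 + 2s`:
`(1 − 16/(ps))(1 − ω/p²) ≤ (1 − (ω + N)/p²) · p/(p − 1)`. [folklore] -/
private theorem localFactor_poly {p s ω N : ℝ} (hp : 11 ≤ p) (hss : s * s = p) (hs3 : 3 ≤ s)
    (hω : ω ≤ 3 * p - 2) (hN : N ≤ p + 1 + 2 * s) :
    (1 - 16 / (p * s)) * (1 - ω / p ^ 2) ≤ (1 - (ω + N) / p ^ 2) * (p / (p - 1)) := by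
  have hp0 : 0 < p := by linarith
  have hs0 : 0 < s := by linarith
  have hp1 : 0 < p - 1 := by linarith
  have hp0' : p ≠ 0 := hp0.ne'
  have hs0' : s ≠ 0 := hs0.ne'
  have hp1' : p - 1 ≠ 0 := hp1.ne'
  have hps : 0 < p * s := mul_pos hp0 hs0
  rw [← sub_nonneg]
  have key : (1 - (ω + N) / p ^ 2) * (p / (p - 1)) - (1 - 16 / (p * s)) * (1 - ω / p ^ 2) =
      (p * s * (p ^ 2 - p * N - ω) + 16 * (p ^ 2 - ω) * (p - 1)) / (p ^ 3 * s * (p - 1)) := by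
    field_simp
    ring
  rw [key]
  refine div_nonneg ?_ (mul_pos (mul_pos (pow_pos hp0 3) hs0) hp1).le
  have hpN : p * N ≤ p * (p + 1 + 2 * s) := mul_le_mul_of_nonneg_left hN hp0.le
  have hin : -4 * p + 2 - 2 * p * s ≤ p ^ 2 - p * N - ω := by nlinarith
  have hA : p * s * (-4 * p + 2 - 2 * p * s) ≤ p * s * (p ^ 2 - p * N - ω) :=
    mul_le_mul_of_nonneg_left hin hps.le
  have hB' : (p ^ 2 - 3 * p + 2) * (p - 1) ≤ (p ^ 2 - ω) * (p - 1) :=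
    mul_le_mul_of_nonneg_right (by linarith) hp1.le
  have hsp : s ≤ p / 3 := by
    rw [le_div_iff₀ (by norm_num : (0 : ℝ) < 3)]
    nlinarith
  have hC : p ^ 2 * s ≤ p ^ 2 * (p / 3) := mul_le_mul_of_nonneg_left hsp (sq_nonneg p)
  have hD : 0 ≤ p * s := hps.le
  have hE : 0 ≤ p ^ 2 * (p - 11) := mul_nonneg (sq_nonneg p) (by linarith)
  have hF : 11 * p ≤ p ^ 2 := by nlinarith
  have hss2 : p ^ 2 * (s * s) = p ^ 2 * p := by rw [hss]
  nlinarith [hA, hB', hC, hD, hE, hF, hss2]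

/-- The exponent `t(p)` of the local-factor floor `e^{−t(p)}`: `log 4` (plus a harmless
`32/p^{3/2}`) for `p < 11`, `32/p^{3/2}` for `p ≥ 11`; summable. [folklore] -/
def localExponent (p : ℕ) : ℝ :=
  (if p < 11 then Real.log 4 else 0) + 32 / (p : ℝ) ^ (3 / 2 : ℝ)

/-- `t(p) ≥ 0`. [cite: IrelandRosen1990, Ch. 8 §3 and §7 Thm 5] -/
theorem localExponent_nonneg (p : ℕ) : 0 ≤ localExponent p := by
  unfold localExponent
  have h4 : 0 ≤ Real.log 4 := Real.log_nonneg (by norm_num)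
  have : 0 ≤ 32 / (p : ℝ) ^ (3 / 2 : ℝ) := by positivity
  split_ifs <;> linarith

/-- `∑_p t(p) < ∞` (`t(p) ≪ p^{−3/2}`). [cite: IrelandRosen1990, Ch. 8 §3 and §7 Thm 5] -/
theorem summable_localExponent : Summable localExponent := by
  have h1 : Summable (fun p : ℕ => if p < 11 then Real.log 4 else (0 : ℝ)) := by
    refine summable_of_ne_finset_zero (s := range 11) fun p hp => ?_
    rw [mem_range] at hp
    rw [if_neg hp]
  have h2 : Summable (fun p : ℕ => 32 / (p : ℝ) ^ (3 / 2 : ℝ)) := by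
    have h := (Real.summable_one_div_nat_rpow.mpr (by norm_num : (1 : ℝ) < 3 / 2)).mul_left 32
    exact h.congr fun p => by rw [mul_one_div]
  exact h1.add h2

/-- **The local factor at one prime, bounded below uniformly in even `n`**:
`e^{−t(p)} · (1 − ω(p)/p²) ≤ (1 − Ω_n(p)/p²) · p/(p − 1)` — for `p < 11` from `Ω_n(p)/p² ≤ 3/4`, for
`p ≥ 11` from `Ω_n(p) ≤ ω(p) + p + 1 + 2√p` (Hasse), i.e. `1 − (local factor) ≪ p^{−3/2}`.
[cite: IrelandRosen1990, Ch. 8 §3 and §7 Thm 5] -/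
theorem exp_neg_localExponent_mul_le {n : ℕ} (hn : Even n) {p : ℕ} (hp : p.Prime) :
    Real.exp (-localExponent p) * (1 - (pairZeroCount p : ℝ) / (p : ℝ) ^ 2) ≤
      (1 - (twoClassCount n p : ℝ) / (p : ℝ) ^ 2) * ((p : ℝ) / ((p : ℝ) - 1)) := by
  haveI := Fact.mk hp
  have hp2 : (2 : ℝ) ≤ p := by exact_mod_cast hp.two_le
  have hω := pairZeroCount_le hp
  have hV1 := one_sub_pairZeroCount_div_bounds hp
  have hV0 : 0 ≤ 1 - (pairZeroCount p : ℝ) / (p : ℝ) ^ 2 := by linarith [hV1.1]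
  have hΩb := twoClassDensity_prime_bounds hn hp
  rw [twoClassDensity_prime n hp] at hΩb
  have hpp : 1 ≤ (p : ℝ) / ((p : ℝ) - 1) := by
    rw [le_div_iff₀ (by linarith)]; linarith
  have hR0 : 1 / 4 ≤ (1 - (twoClassCount n p : ℝ) / (p : ℝ) ^ 2) * ((p : ℝ) / ((p : ℝ) - 1)) := by
    calc (1 : ℝ) / 4 = 1 / 4 * 1 := by ring
      _ ≤ _ := mul_le_mul (by linarith [hΩb.2.2]) hpp zero_le_one (by linarith [hΩb.2.2])
  by_cases h11 : p < 11
  · have ht : Real.log 4 ≤ localExponent p := by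
      rw [localExponent, if_pos h11]
      have : 0 ≤ 32 / (p : ℝ) ^ (3 / 2 : ℝ) := by positivity
      linarith
    have hexp : Real.exp (-localExponent p) ≤ 1 / 4 := by
      calc Real.exp (-localExponent p) ≤ Real.exp (-Real.log 4) := Real.exp_le_exp.mpr (by linarith)
        _ = 1 / 4 := by rw [Real.exp_neg, Real.exp_log (by norm_num), inv_eq_one_div]
    calc Real.exp (-localExponent p) * (1 - (pairZeroCount p : ℝ) / (p : ℝ) ^ 2) ≤ 1 / 4 * 1 :=
          mul_le_mul hexp hV1.2 hV0 (by norm_num)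
      _ ≤ _ := by linarith [hR0]
  · push Not at h11
    have h11' : (11 : ℝ) ≤ p := by exact_mod_cast h11
    obtain ⟨s, hs_def⟩ : ∃ s : ℝ, s = Real.sqrt p := ⟨_, rfl⟩
    have hs0 : 0 ≤ s := by rw [hs_def]; exact Real.sqrt_nonneg _
    have hss : s * s = p := by rw [hs_def]; exact Real.mul_self_sqrt (by linarith)
    have hs3 : 3 ≤ s := by
      by_contra h
      push Not at h
      have : s * s < 9 := by nlinarith
      linarith
    have hp32 : (p : ℝ) ^ (3 / 2 : ℝ) = p * s := by
      rw [show (3 / 2 : ℝ) = 1 + 1 / 2 by norm_num, Real.rpow_add (by linarith), Real.rpow_one,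
        ← Real.sqrt_eq_rpow, hs_def]
    have hps : 0 < (p : ℝ) * s := by positivity
    have ht : localExponent p = 2 * (16 / (p * s)) := by
      rw [localExponent, if_neg (not_lt.mpr h11), hp32, zero_add]
      ring
    have hb0 : 0 ≤ 16 / ((p : ℝ) * s) := by positivity
    have hb2 : 16 / ((p : ℝ) * s) ≤ 1 / 2 := by
      rw [div_le_iff₀ hps]
      nlinarith
    have hexp : Real.exp (-localExponent p) ≤ 1 - 16 / (p * s) := by
      rw [ht]
      exact exp_neg_two_mul_le hb0 hb2
    refine (mul_le_mul_of_nonneg_right hexp hV0).trans ?_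
    by_cases hpn : p ∣ n
    · rw [twoClassCount_prime_of_dvd hp hpn]
      calc (1 - 16 / ((p : ℝ) * s)) * (1 - (pairZeroCount p : ℝ) / (p : ℝ) ^ 2)
          ≤ 1 * (1 - (pairZeroCount p : ℝ) / (p : ℝ) ^ 2) :=
            mul_le_mul_of_nonneg_right (by linarith) hV0
        _ ≤ _ := by rw [one_mul]; exact le_mul_of_one_le_right hV0 hpp
    · rw [twoClassCount_prime_of_not_dvd hp hpn, Nat.cast_add]
      have hn0 : (n : ZMod p) ≠ 0 := fun h => hpn ((ZMod.natCast_eq_zero_iff n p).mp h)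
      have hN : (cubicPairCount (n : ZMod p) : ℝ) ≤ p + 1 + 2 * s := by
        rw [hs_def]; exact cubicPairCount_le_add_two_sqrt hn0
      exact localFactor_poly h11' hss hs3 hω hN

/-- `P(z)/φ(P(z)) = ∏_{p<z} p/(p − 1)` (private copy of `CubicMinorant.primesProdBelow_div_totient`). [folklore] -/
private theorem primesProdBelow_div_totient_aux (z : ℝ) :
    (primesProdBelow z : ℝ) / (Nat.totient (primesProdBelow z) : ℝ) =
      ∏ p ∈ Nat.primesBelow ⌈z⌉₊, ((p : ℝ) / ((p : ℝ) - 1)) := by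
  have hsq : Squarefree (primesProdBelow z) := squarefree_primesProdBelow z
  have hpf : (primesProdBelow z).primeFactors = Nat.primesBelow ⌈z⌉₊ :=
    primeFactors_primesProdBelow z
  have h1 : (∏ p ∈ (primesProdBelow z).primeFactors, p) = primesProdBelow z :=
    Nat.prod_primeFactors_of_squarefree hsq
  have h2 := Nat.totient_mul_prod_primeFactors (primesProdBelow z)
  rw [h1] at h2
  have hP0 : 0 < primesProdBelow z := Nat.pos_of_ne_zero (primesProdBelow_ne_zero z)
  have hφ : Nat.totient (primesProdBelow z) = ∏ p ∈ (primesProdBelow z).primeFactors, (p - 1) := by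
    rw [mul_comm] at h2
    exact Nat.eq_of_mul_eq_mul_left hP0 h2
  have hnum : (primesProdBelow z : ℝ) = ∏ p ∈ Nat.primesBelow ⌈z⌉₊, (p : ℝ) := by
    rw [← hpf, ← Nat.cast_prod, h1]
  have hden : (Nat.totient (primesProdBelow z) : ℝ) =
      ∏ p ∈ Nat.primesBelow ⌈z⌉₊, ((p : ℝ) - 1) := by
    rw [hφ, hpf, Nat.cast_prod]
    refine Finset.prod_congr rfl fun p hp => ?_
    rw [Nat.cast_pred (Nat.prime_of_mem_primesBelow hp).pos]
  rw [hnum, hden, ← Finset.prod_div_distrib]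

/-- The uniform constant `c₁ = exp(−∑_p t(p)) > 0` of the local factors. [folklore] -/
def localFactorConst : ℝ := Real.exp (-(∑' p : ℕ, localExponent p))

/-- `c₁ > 0`. [cite: IrelandRosen1990, Ch. 8 §3 and §7 Thm 5] -/
theorem localFactorConst_pos : 0 < localFactorConst := Real.exp_pos _

/-- **The local factors of the binary problem `n = (x³+2y³) + m`, bounded below uniformly in even `n`**:
`c₁ · V(z) ≤ V_n(z) · P(z)/φ(P(z))` for every `z` and every even `n`, with the absolute
`c₁ = localFactorConst > 0`; i.e. `∏_{p<z} (1 − Ω_n(p)/p²)(1 − 1/p)⁻¹(1 − ω(p)/p²)⁻¹ ≥ c₁`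
(`p ∣ n`: factor `p/(p−1) ≥ 1`; `p ∤ n`: `1 − (p + 1 − ν_p + O(√p)) p/((p²−ω(p))(p−1)) = 1 + O(p^{−3/2})`
by Hasse, `= 3/4` at `p = 3`, `= 1 − 1/(p−1)²` for `p ≡ 2 (mod 3)`).
[cite: IrelandRosen1990, Ch. 8 §3 and §7 Thm 5] -/
theorem localFactorConst_mul_oneClassProduct_le {n : ℕ} (hn : Even n) (z : ℝ) :
    localFactorConst * oneClassProduct z ≤
      twoClassProduct z n * ((primesProdBelow z : ℝ) / (Nat.totient (primesProdBelow z) : ℝ)) := by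
  rw [primesProdBelow_div_totient_aux, twoClassProduct, oneClassProduct, ← prod_mul_distrib,
    localFactorConst]
  set S := Nat.primesBelow ⌈z⌉₊ with hS
  have hsum : ∑ p ∈ S, localExponent p ≤ ∑' p, localExponent p :=
    Summable.sum_le_tsum S (fun p _ => localExponent_nonneg p) summable_localExponent
  have hV0 : 0 ≤ ∏ p ∈ S, (1 - (pairZeroCount p : ℝ) / (p : ℝ) ^ 2) :=
    prod_nonneg fun p hp => by linarith [(one_sub_pairZeroCount_div_bounds (Nat.prime_of_mem_primesBelow hp)).1]
  calc Real.exp (-(∑' p, localExponent p)) * ∏ p ∈ S, (1 - (pairZeroCount p : ℝ) / (p : ℝ) ^ 2)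
      ≤ Real.exp (-(∑ p ∈ S, localExponent p)) * ∏ p ∈ S, (1 - (pairZeroCount p : ℝ) / (p : ℝ) ^ 2) :=
        mul_le_mul_of_nonneg_right (Real.exp_le_exp.mpr (by linarith)) hV0
    _ = ∏ p ∈ S, (Real.exp (-localExponent p) * (1 - (pairZeroCount p : ℝ) / (p : ℝ) ^ 2)) := by
        rw [prod_mul_distrib, ← Real.exp_sum, ← sum_neg_distrib]
    _ ≤ ∏ p ∈ S, ((1 - (twoClassCount n p : ℝ) / (p : ℝ) ^ 2) * ((p : ℝ) / ((p : ℝ) - 1))) :=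
        prod_le_prod (fun p hp => mul_nonneg (Real.exp_nonneg _)
            (by linarith [(one_sub_pairZeroCount_div_bounds (Nat.prime_of_mem_primesBelow hp)).1]))
          fun p hp => exp_neg_localExponent_mul_le hn (Nat.prime_of_mem_primesBelow hp)

/-- `c₁ ≤ 1`. [cite: IrelandRosen1990, Ch. 8 §3 and §7 Thm 5] -/
theorem localFactorConst_le_one : localFactorConst ≤ 1 := by
  rw [localFactorConst, ← Real.exp_zero]
  have h0 : 0 ≤ ∑' p : ℕ, localExponent p := tsum_nonneg localExponent_nonneg
  exact Real.exp_le_exp.mpr (by linarith)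

/-- **Main term of the two-class count with the local factors extracted** (the form the binary
problem `n = (x³+2y³) + m`, `m` rough, consumes): for even `n` above the box, `2 ≤ z ≤ D`, `2 ≤ D`,
`(P(z)/φ(P(z))) · T(z) ≥ c₁ L² V(z) − C (L² V(z) e^{−log D/log z} + (P(z)/φ(P(z))) (L + D) D (log D)^16)`
with the absolute `c₁ = localFactorConst > 0` and `C`, `V(z) = oneClassProduct z` the one-class
product (so that, divided by the one-class count `≈ L² V(z)`, the normalised binary count is `≥ c₁ − o(1)`).
[cite: HalberstamRichert1974, Thm 2.5 (Fundamental Lemma) with Thm 2.2] -/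
theorem twoClassCount_box_weighted_ge :
    ∃ C : ℝ, 0 < C ∧ ∀ (A A' L n : ℕ) (z D : ℝ), Even n → (A + L) ^ 3 + 2 * (A' + L) ^ 3 < n →
      2 ≤ z → z ≤ D → 2 ≤ D →
      localFactorConst * ((L : ℝ) ^ 2 * oneClassProduct z) -
          C * ((L : ℝ) ^ 2 * oneClassProduct z * Real.exp (-(Real.log D / Real.log z)) +
            ((primesProdBelow z : ℝ) / (Nat.totient (primesProdBelow z) : ℝ)) *
              (((L : ℝ) + D) * D * Real.log D ^ 16)) ≤
        ((primesProdBelow z : ℝ) / (Nat.totient (primesProdBelow z) : ℝ)) *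
          (#{xy ∈ pairBox A A' L | (pairValue xy).Coprime (primesProdBelow z) ∧
            (n - pairValue xy).Coprime (primesProdBelow z)} : ℝ) := by
  obtain ⟨C, hC, h⟩ := abs_twoClassCount_box_sub_le
  refine ⟨C, hC, fun A A' L n z D hn htop hz hzD hD => ?_⟩
  have hT := (abs_le.mp (h A A' L n z D hn htop hz hzD hD)).1
  set T := (#{xy ∈ pairBox A A' L | (pairValue xy).Coprime (primesProdBelow z) ∧
      (n - pairValue xy).Coprime (primesProdBelow z)} : ℝ) with hTdef
  set Q := (primesProdBelow z : ℝ) / (Nat.totient (primesProdBelow z) : ℝ) with hQ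
  set V := oneClassProduct z with hVdef
  set Vn := twoClassProduct z n with hVndef
  set ε := Real.exp (-(Real.log D / Real.log z)) with hε
  set E := ((L : ℝ) + D) * D * Real.log D ^ 16 with hEdef
  have hQ0 : 0 ≤ Q := by rw [hQ]; positivity
  have hT0 : 0 ≤ T := by rw [hTdef]; exact Nat.cast_nonneg _
  have hloc : localFactorConst * V ≤ Vn * Q := localFactorConst_mul_oneClassProduct_le hn z
  have hc1 := localFactorConst_le_one
  have hc0 := localFactorConst_pos.le
  have hV0 : 0 ≤ V := (oneClassProduct_pos z).le
  have hL0 : (0 : ℝ) ≤ (L : ℝ) ^ 2 := sq_nonneg _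
  have hε0 : 0 ≤ ε := Real.exp_nonneg _
  have hE0 : 0 ≤ E := by
    have hD0 : 0 ≤ D := by linarith
    have : 0 ≤ Real.log D := Real.log_nonneg (by linarith)
    rw [hEdef]; positivity
  have hLV0 : 0 ≤ (L : ℝ) ^ 2 * V := mul_nonneg hL0 hV0
  have hQE0 : 0 ≤ Q * E := mul_nonneg hQ0 hE0
  have hLVε0 : 0 ≤ (L : ℝ) ^ 2 * V * ε := mul_nonneg hLV0 hε0
  -- the FL lower half, multiplied by `Q ≥ 0`
  have h1 : (L : ℝ) ^ 2 * Vn - C * ((L : ℝ) ^ 2 * Vn * ε + E) ≤ T := by linarith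
  have h2 : Q * ((L : ℝ) ^ 2 * Vn - C * ((L : ℝ) ^ 2 * Vn * ε + E)) ≤ Q * T :=
    mul_le_mul_of_nonneg_left h1 hQ0
  by_cases hsign : 0 ≤ 1 - C * ε
  · -- `Q L² Vn (1 − Cε) ≥ c₁ L² V (1 − Cε)`
    have h3 : (L : ℝ) ^ 2 * (1 - C * ε) * (localFactorConst * V) ≤
        (L : ℝ) ^ 2 * (1 - C * ε) * (Vn * Q) :=
      mul_le_mul_of_nonneg_left hloc (mul_nonneg hL0 hsign)
    -- `c₁ C L² V ε ≤ C L² V ε`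
    have h4 : localFactorConst * (C * ((L : ℝ) ^ 2 * V * ε)) ≤ 1 * (C * ((L : ℝ) ^ 2 * V * ε)) :=
      mul_le_mul_of_nonneg_right hc1 (mul_nonneg hC.le hLVε0)
    nlinarith [h2, h3, h4, hQE0]
  · push Not at hsign
    -- the claimed bound is `≤ 0 ≤ Q T`
    have h5 : localFactorConst * ((L : ℝ) ^ 2 * V) - C * ((L : ℝ) ^ 2 * V * ε) ≤ 0 := by
      have : localFactorConst * ((L : ℝ) ^ 2 * V) ≤ (C * ε) * ((L : ℝ) ^ 2 * V) :=
        mul_le_mul_of_nonneg_right (by linarith) hLV0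
      nlinarith [this]
    have h6 : 0 ≤ C * (Q * E) := mul_nonneg hC.le hQE0
    nlinarith [mul_nonneg hQ0 hT0, h5, h6]

end Literature.NumberTheory.Sieve.CubicPrimes

end
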